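import Summits.BirchSwinnertonDyer.BirchSwinnertonDyer.Theorems.ThetaPartnerAtTwoSignedControlAtTwoShaThreeBaseKilling
import Literature.NumberTheory.GaloisRepresentations.HilbertNinetySubgroup
import Literature.NumberTheory.GaloisRepresentations.RestrictionCalculus
import Literature.NumberTheory.GaloisRepresentations.LocalGlobalCohomologyTateProofs
import Literature.NumberTheory.GaloisRepresentations.BrauerTower
import Literature.NumberTheory.EllipticCurves.KummerSequenceConnecting
import Mathlib.GroupTheory.SpecificGroups.Cyclic
import HarnessLib

/-!
# A class of `H²(F, T)` (`T` trivial of order `2`) vanishing at the real places and off `S` dies on an open normal `U`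
# whose local index at each `v ∈ S` is even (K4 `SignedControlAtTwo`, base case of Milne I 4.10 (c)₃, bricks B0 + B2 in `T`)

Route `ThetaPartnerAtTwo` (TP2), crux K4 `SignedControlAtTwo` (stmt-BirchSwinnertonDyer-20309), line `eulerchar` v12, stub
`stub_poitouTateThreeRealRat`; width seat `bsd-wall-tp2-p3-w2` gen 7 (`--supports stmt-BirchSwinnertonDyer-20309`, helper).
Transport of brick B2 (`…ShaThreeBaseKilling.resH_kummer_eq_zero_of_dvd_localIndex`, stated for `μ₂` and the Brauer group) to an
arbitrary TRIVIAL discrete `Γ_F`-module `T` of order `2`: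

* `mu_two_apply` — `Γ_F` acts trivially on `μ₂` (`±1 ∈ F`);
* `resH_mu_eq_zero_of_resH_kummer_eq_zero` — Kummer injectivity on `Γ_{F'} = galFixing F F'`: `res (Kummer c) = 0` in
  `H²(Γ_{F'}, F̄ˣ)` forces `res c = 0` in `H²(Γ_{F'}, μ_N)` (Hilbert 90 for `Γ_{F'}`, tree `subsingleton_one_units_galFixing`);
* **`resH_eq_zero_of_dvd_localIndex`** — for `T` trivial with `#T = 2`, `U = Γ_{F'}` open normal, `y ∈ H²(F, T)` vanishing at the
  real places and at the finite `v ∉ S`, with `2 ∣ [Γ_{F_v} : res_v⁻¹ U]` for `v ∈ S`: `res_U y = 0` (transport `T ≅ μ₂` and B2).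

HONEST FRAMING: THEOREMS ONLY (no definition, no named fact, no `sorry`); closes no item; BSD is not proved by any of this.
References: [SerreGaloisCohomology1997] II §1.2, II §4.4 Prop. 13; [SerreLocalFields1979] X §1 Prop. 2.
-/

set_option autoImplicit false
-- the Theorems namespace of this sub repeats the summit name by design (D-0017 nested layout)
set_option linter.dupNamespace false

noncomputable section

open CategoryTheory Function Field NumberField IsDedekindDomain
open scoped NumberField
open _root_.TopRep _root_.ContRepresentation _root_.ContinuousCohomology
open Literature.NumberTheory.GaloisRepresentations
open Literature.NumberTheory.GaloisRepresentations.DiscreteGaloisModule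
open Literature.NumberTheory.GaloisRepresentations.LocalWeilDatum

namespace Summit.BirchSwinnertonDyer.BirchSwinnertonDyer.Theorems.SignedEC.ShaThreeBase

section Transport

variable {F : Type} [Field F] [NumberField F]

omit [NumberField F] in
/-- **`Γ_F` acts trivially on `μ₂`** (the square roots of unity `±1` lie in `F`). [folklore] -/
theorem mu_two_apply (σ : absoluteGaloisGroup F) (ζ : MuCarrier F 2) : (mu F 2) σ ζ = ζ := by
  apply muVal_injective F 2
  have h2 : (muVal F 2 ζ : AlgebraicClosure F) * muVal F 2 ζ = 1 := by
    rw [← Units.val_mul, ← pow_two, muVal_pow_eq_one F 2 ζ, Units.val_one]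
  rcases mul_self_eq_one_iff.1 h2 with h | h
  · apply Units.ext
    change ((σ • ((MuCarrier.toAdditive ζ).toMul : rootsOfUnity 2 (AlgebraicClosure F)) :
      rootsOfUnity 2 (AlgebraicClosure F)) : (AlgebraicClosure F)ˣ) = (muVal F 2 ζ : AlgebraicClosure F)
    rw [absoluteGaloisGroup.coe_smul_rootsOfUnity, Units.coe_smul]
    change σ • (muVal F 2 ζ : AlgebraicClosure F) = _
    rw [h, smul_one]
  · apply Units.ext
    change ((σ • ((MuCarrier.toAdditive ζ).toMul : rootsOfUnity 2 (AlgebraicClosure F)) :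
      rootsOfUnity 2 (AlgebraicClosure F)) : (AlgebraicClosure F)ˣ) = (muVal F 2 ζ : AlgebraicClosure F)
    rw [absoluteGaloisGroup.coe_smul_rootsOfUnity, Units.coe_smul]
    change σ • (muVal F 2 ζ : AlgebraicClosure F) = _
    rw [h, smul_neg, smul_one]

/-- **Kummer injectivity on `Γ_{F'}`**: for a finite subextension `F' ⊆ F̄` and `c ∈ H²(Γ_F, μ_N)`, if the restriction to
`Γ_{F'} = galFixing F F'` of the Brauer class of `c` vanishes, then so does the restriction of `c` in `H²(Γ_{F'}, μ_N)`
(the Kummer sequence restricted to `Γ_{F'}` and Hilbert 90 `H¹(Γ_{F'}, F̄ˣ) = 0`). [cite: SerreLocalFields1979, X §1 Prop. 2]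
[cite: SerreGaloisCohomology1997, II §1.2 Prop. 1] -/
theorem resH_mu_eq_zero_of_resH_kummer_eq_zero (F' : IntermediateField F (AlgebraicClosure F)) [FiniteDimensional F F']
    {N : ℕ} [NeZero N]
    (c : galoisCohomology (mu F N) 2)
    (h : resH (galFixing F F') (units F) 2 ((cohomologyMap (kummerι F N) 2).hom c) = 0) :
    resH (galFixing F F') (mu F N) 2 c = 0 := by
  haveI : IsClosed ((galFixing F F' : Subgroup (absoluteGaloisGroup F)) : Set (absoluteGaloisGroup F)) :=
    Subgroup.isClosed_of_isOpen _ (isOpen_galFixing F F')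
  haveI : CompactSpace (galFixing F F') := compactSpace_of_isClosed_subgroup
  have hSES := (isSES_kummer F N (NeZero.pos N)).res (galFixing F F')
  have hnat : cohomologyMap (resModHom (galFixing F F') (kummerι F N)) 2 (resH (galFixing F F') (mu F N) 2 c) =
      resH (galFixing F F') (units F) 2 ((cohomologyMap (kummerι F N) 2).hom c) := by
    let hK : TopRep.res (subgroupIncl (galFixing F F') : galFixing F F' →* absoluteGaloisGroup F) (mu F N).toTopRep ⟶
        ((units F).restrict (subgroupIncl (galFixing F F'))).toTopRep :=
      TopRep.ofHom ⟨(kummerι F N).hom.toContinuousLinearMap,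
        fun n => (kummerι F N).hom.isIntertwining' (n : absoluteGaloisGroup F)⟩
    change ContinuousCohomology.map _ _ 2 (ContinuousCohomology.map _ _ 2 c) =
      ContinuousCohomology.map _ _ 2 (ContinuousCohomology.map _ _ 2 c)
    refine (map_comp_apply_of _ _ (subgroupIncl (galFixing F F')) (fun _ => rfl) _ _ hK (fun _ => rfl) 2 c).symm.trans ?_
    exact map_comp_apply_of _ _ (subgroupIncl (galFixing F F')) (fun _ => rfl) _ _ hK (fun _ => rfl) 2 c
  rw [← hnat] at h
  obtain ⟨x, hx⟩ := hSES.exists_δ₁_eq_of_map_two_eq_zero _ h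
  haveI := subsingleton_one_units_galFixing (k := F) F'
  rw [← hx, Subsingleton.elim x 0, map_zero]

variable {T : Type} [AddCommGroup T] [TopologicalSpace T] [DiscreteTopology T]
variable (σT : DiscreteGaloisModule F T)

/-- **Transport `T ≅ μ₂` and B2**: for `T` trivial of order `2`, `F' ⊆ F̄` finite with `U = Γ_{F'}` normal, and `y ∈ H²(F, T)`
vanishing at every real place and at the finite places outside `S`, with `2 ∣ [Γ_{F_v} : res_v⁻¹(U)]` for `v ∈ S`:
`res_U y = 0` in `H²(U, T)`. [cite: SerreGaloisCohomology1997, II §4.4 Prop. 13] [cite: CasselsFrohlichANT1967, Ch. VII §9.6–§10] -/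
theorem resH_eq_zero_of_dvd_localIndex (htriv : ∀ (x : absoluteGaloisGroup F) (t : T), σT x t = t) (hT : Nat.card T = 2)
    (F' : IntermediateField F (AlgebraicClosure F)) [FiniteDimensional F F'] [hUn : (galFixing F F').Normal]
    (y : galoisCohomology σT 2) (S : Finset (HeightOneSpectrum (𝓞 F)))
    (hS : ∀ v ∉ S, galoisCohomology.localization σT (Sum.inr v) 2 y = 0)
    (hbad : ∀ v ∈ S, 2 ∣ ((galFixing F F').comap ((absGaloisRestrict F (v.adicCompletion F) :
        absoluteGaloisGroup (v.adicCompletion F) →ₜ* absoluteGaloisGroup F) :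
        absoluteGaloisGroup (v.adicCompletion F) →* absoluteGaloisGroup F)).index)
    (hreal : ∀ w : InfinitePlace F, w.IsReal → galoisCohomology.localization σT (Sum.inl w) 2 y = 0) :
    resH (galFixing F F') σT 2 y = 0 := by
  classical
  haveI : Fact (Nat.Prime 2) := ⟨Nat.prime_two⟩
  -- the `Γ_F`-equivariant identification `T ≅ μ₂`
  let Φ : T ≃+ MuCarrier F 2 := addEquivOfPrimeCardEq hT (natCard_muCarrier (K := F) (n := 2))
  let f : σT.toTopRep ⟶ (mu F 2).toTopRep :=
    TopRep.ofHom ⟨⟨Φ.toAddMonoidHom.toIntLinearMap, continuous_of_discreteTopology⟩, fun σ => by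
      ext t
      change Φ (σT σ t) = (mu F 2) σ (Φ t)
      rw [htriv, mu_two_apply]⟩
  let g : (mu F 2).toTopRep ⟶ σT.toTopRep :=
    TopRep.ofHom ⟨⟨Φ.symm.toAddMonoidHom.toIntLinearMap, continuous_of_discreteTopology⟩, fun σ => by
      ext m
      change Φ.symm ((mu F 2) σ m) = σT σ (Φ.symm m)
      rw [htriv, mu_two_apply]⟩
  have hgf : ∀ t, g.hom (f.hom t) = t := fun t => Φ.symm_apply_apply t
  -- push `y` to `μ₂`
  set c : galoisCohomology (mu F 2) 2 := (cohomologyMap f 2).hom y with hc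
  -- localisations of `c` vanish where those of `y` do
  have hloc : ∀ v : Place F, galoisCohomology.localization (mu F 2) v 2 c =
      cohomologyMap (resFieldHom (Place.Completion v) f) 2 (galoisCohomology.localization σT v 2 y) := by
    intro v
    let hv : TopRep.res (absGaloisRestrict F (Place.Completion v) :
        absoluteGaloisGroup (Place.Completion v) →* absoluteGaloisGroup F) σT.toTopRep ⟶
        ((mu F 2).toLocal v).toTopRep :=
      TopRep.ofHom ⟨⟨Φ.toAddMonoidHom.toIntLinearMap, continuous_of_discreteTopology⟩, fun σ => by
        ext t; change Φ (σT _ t) = (mu F 2) _ (Φ t); rw [htriv, mu_two_apply]⟩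
    change ContinuousCohomology.map _ _ 2 (ContinuousCohomology.map _ _ 2 y) =
      ContinuousCohomology.map _ _ 2 (ContinuousCohomology.map _ _ 2 y)
    refine (map_comp_apply_of _ _ (absGaloisRestrict F (Place.Completion v)) (fun _ => rfl) _ _ hv (fun _ => rfl) 2 y).symm.trans ?_
    exact map_comp_apply_of _ _ (absGaloisRestrict F (Place.Completion v)) (fun _ => rfl) _ _ hv (fun _ => rfl) 2 y
  have hS' : ∀ v ∉ S, galoisCohomology.localization (mu F 2) (Sum.inr v) 2 c = 0 := fun v hv => by
    rw [hloc, hS v hv]; exact map_zero _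
  have hreal' : ∀ w : InfinitePlace F, w.IsReal →
      haveI : CompactSpace (absoluteGaloisGroup F) := absoluteGaloisGroup_compactSpace F
      haveI : CompactSpace (absoluteGaloisGroup w.Completion) := absoluteGaloisGroup_compactSpace _
      galoisCohomology.localization (mu F 2) (Sum.inl w) 2 c = 0 := fun w hw => by
    have := hloc (Sum.inl w)
    rw [hreal w hw] at this
    exact this.trans (map_zero _)
  -- B2 in `μ₂`, then Kummer injectivity on `U`
  have hU := resH_kummer_eq_zero_of_dvd_localIndex F (galFixing F F') (isOpen_galFixing F F') c S hS' hbad hreal'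
  have hμ := resH_mu_eq_zero_of_resH_kummer_eq_zero F' c hU
  -- back to `T`: `res_U y = H²(g|_U) (res_U c)`
  have hback : resH (galFixing F F') σT 2 y =
      cohomologyMap (resModHom (galFixing F F') g) 2 (resH (galFixing F F') (mu F 2) 2 c) := by
    rw [hc]
    let hy' : TopRep.res (subgroupIncl (galFixing F F') : galFixing F F' →* absoluteGaloisGroup F) σT.toTopRep ⟶
        ((mu F 2).restrict (subgroupIncl (galFixing F F'))).toTopRep :=
      TopRep.ofHom ⟨⟨Φ.toAddMonoidHom.toIntLinearMap, continuous_of_discreteTopology⟩, fun σ => by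
        ext t; change Φ (σT _ t) = (mu F 2) _ (Φ t); rw [htriv, mu_two_apply]⟩
    change ContinuousCohomology.map _ _ 2 y =
      ContinuousCohomology.map _ _ 2 (ContinuousCohomology.map _ _ 2 (ContinuousCohomology.map _ _ 2 y))
    rw [← map_comp_apply_of (ContinuousMonoidHom.id _) (subgroupIncl (galFixing F F')) (subgroupIncl (galFixing F F'))
        (fun _ => rfl) _ _ hy' (fun _ => rfl) 2 y]
    exact map_comp_apply_of _ _ (subgroupIncl (galFixing F F')) (fun _ => rfl) hy' _ _ (fun t => (hgf t).symm) 2 y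
  rw [hback, hμ]; exact map_zero _

end Transport

end Summit.BirchSwinnertonDyer.BirchSwinnertonDyer.Theorems.SignedEC.ShaThreeBase

end
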